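import Summits.CriticalPhenomena.PercolationContinuityZ3.Theorems.PercNearOneGluingNoHeavyLowerTailThreePointHalvingCrossTerminalPair
import HarnessLib

/-!
# The edge-induction schema for the halving lemma (v) needs the cross inequality only at NON-TERMINAL pairs
# (Sahi programme, prover prim-sahi-p2 gen 46)

Support file (`--supports stmt-CriticalPhenomena-4575`, helper), sharpening gen 45's `HalvingCross.halvingUD_of_cross` with gen 46's
`cross_sharp_at_as` / `infl_U_at_sc_eq_zero`.  No definitions, no named facts, no sorries; standard axioms.
* `halvingUD_of_cross_nonterminal` [this work] — **(v) `P(U)·P(D) ≤ 2·P(U ∩ D)` holds under EVERY `prodBernoulli w` provided the cross inequality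
  (XI) `μ(U)ν(D) + ν(U)μ(D) ≤ 2μ(X) + 2ν(X)` (`μ = P_{w[e↦0]}`, `ν = P_{w[e↦1]}`) holds at every fractional pair `e` that is NOT one of the
  terminal pairs `as, ac, sc`, and only in the situation where both minors already satisfy (v) (`F(μ) ≥ 0`, `F(ν) ≥ 0`, the induction
  hypotheses).**  The terminal pairs are discharged inside the induction: at `as`/`ac` by the sharp theorem `cross_sharp_at_as`
  (`F(μ)+F(ν) ≥ 4·I_U I_D ≥ I_U I_D`), at `sc` by `I_U = 0`.
So the open content of (v) is a single four- or five-point row: (XI) at pairs with a non-terminal end (memo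
`FROM-prim-sahi-p2-gen46-TWO-HUB-PIECE.md`, ADDENDUM A).  Nothing here asserts (XI).
-/

noncomputable section

namespace Summit.CriticalPhenomena.PercolationContinuityZ3.Theorems

namespace HalvingCross

open MeasureTheory Literature.Probability.Percolation Literature.Probability.LatticeModels EdgeInduction
open scoped Classical

variable {n : ℕ}

/-- The cross inequality at a pair follows from `F(μ)+F(ν) ≥ 4·I_U·I_D` once both minors satisfy (v). [this work] -/
theorem cross_of_sharp {x0 x1 u0 u1 d0 d1 : ℝ} (h0 : u0 * d0 ≤ 2 * x0) (h1 : u1 * d1 ≤ 2 * x1)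
    (hs : 4 * (u1 - u0) * (d0 - d1) ≤ (2 * x0 - u0 * d0) + (2 * x1 - u1 * d1)) :
    u0 * d1 + u1 * d0 ≤ 2 * x0 + 2 * x1 := by
  by_cases hI : 0 ≤ (u1 - u0) * (d0 - d1)
  · nlinarith
  · nlinarith

/-- **THE SCHEMA, NON-TERMINAL FORM.**  If for every weight function `w` and every fractional pair `e ∉ {as, ac, sc}` the cross inequality
(XI) holds whenever both minors satisfy (v), then the halving lemma (v) holds under every `prodBernoulli w`. [this work] -/
theorem halvingUD_of_cross_nonterminal (s a c : Fin n) (has : a ≠ s) (hac : a ≠ c) (hsc : s ≠ c)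
    (h : ∀ (w : Sym2 (Fin n) → unitInterval) (e : Sym2 (Fin n)), e ∈ fracEdges w → e ≠ s(a, s) → e ≠ s(a, c) → e ≠ s(s, c) →
      (prodBernoulli (Function.update w e 0)).real (openConn s a ∪ openConn c a) *
          (prodBernoulli (Function.update w e 0)).real ((openConn s c)ᶜ) ≤
        2 * (prodBernoulli (Function.update w e 0)).real ((openConn s a ∪ openConn c a) ∩ (openConn s c)ᶜ) →
      (prodBernoulli (Function.update w e 1)).real (openConn s a ∪ openConn c a) *
          (prodBernoulli (Function.update w e 1)).real ((openConn s c)ᶜ) ≤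
        2 * (prodBernoulli (Function.update w e 1)).real ((openConn s a ∪ openConn c a) ∩ (openConn s c)ᶜ) →
      (prodBernoulli (Function.update w e 0)).real (openConn s a ∪ openConn c a) *
          (prodBernoulli (Function.update w e 1)).real ((openConn s c)ᶜ) +
        (prodBernoulli (Function.update w e 1)).real (openConn s a ∪ openConn c a) *
          (prodBernoulli (Function.update w e 0)).real ((openConn s c)ᶜ) ≤
      2 * (prodBernoulli (Function.update w e 0)).real ((openConn s a ∪ openConn c a) ∩ (openConn s c)ᶜ) +
        2 * (prodBernoulli (Function.update w e 1)).real ((openConn s a ∪ openConn c a) ∩ (openConn s c)ᶜ)) :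
    ∀ w : Sym2 (Fin n) → unitInterval,
      (prodBernoulli w).real (openConn s a ∪ openConn c a) * (prodBernoulli w).real ((openConn s c)ᶜ) ≤
        2 * (prodBernoulli w).real ((openConn s a ∪ openConn c a) ∩ (openConn s c)ᶜ) := by
  suffices H : ∀ (k : ℕ) (w : Sym2 (Fin n) → unitInterval), (fracEdges w).card ≤ k →
      (prodBernoulli w).real (openConn s a ∪ openConn c a) * (prodBernoulli w).real ((openConn s c)ᶜ) ≤
        2 * (prodBernoulli w).real ((openConn s a ∪ openConn c a) ∩ (openConn s c)ᶜ) from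
    fun w => H _ w le_rfl
  intro k
  induction k with
  | zero =>
      intro w hk
      have hw : ∀ e, w e = 0 ∨ w e = 1 := fun e =>
        eq_zero_or_one_of_not_mem_fracEdges (by
          intro he
          have : 0 < (fracEdges w).card := Finset.card_pos.2 ⟨e, he⟩
          omega)
      exact halvingUD_of_zeroOne w hw s a c
  | succ k ih =>
      intro w hk
      by_cases hempty : fracEdges w = ∅
      · have hw : ∀ e, w e = 0 ∨ w e = 1 := fun e => eq_zero_or_one_of_not_mem_fracEdges (by rw [hempty]; simp)
        exact halvingUD_of_zeroOne w hw s a c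
      · obtain ⟨e, he⟩ := Finset.nonempty_iff_ne_empty.2 hempty
        have hcard0 : (fracEdges (Function.update w e 0)).card ≤ k := by
          have h1 := Finset.card_le_card (fracEdges_update_subset w e 0 (Or.inl rfl))
          rw [Finset.card_erase_of_mem he] at h1
          omega
        have hcard1 : (fracEdges (Function.update w e 1)).card ≤ k := by
          have h1 := Finset.card_le_card (fracEdges_update_subset w e 1 (Or.inr rfl))
          rw [Finset.card_erase_of_mem he] at h1
          omega
        have i0 := ih _ hcard0
        have i1 := ih _ hcard1
        -- the cross inequality at `e`: supplied by `h` off the terminal pairs, proved at the terminal pairs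
        have hX : (prodBernoulli (Function.update w e 0)).real (openConn s a ∪ openConn c a) *
              (prodBernoulli (Function.update w e 1)).real ((openConn s c)ᶜ) +
            (prodBernoulli (Function.update w e 1)).real (openConn s a ∪ openConn c a) *
              (prodBernoulli (Function.update w e 0)).real ((openConn s c)ᶜ) ≤
            2 * (prodBernoulli (Function.update w e 0)).real ((openConn s a ∪ openConn c a) ∩ (openConn s c)ᶜ) +
              2 * (prodBernoulli (Function.update w e 1)).real ((openConn s a ∪ openConn c a) ∩ (openConn s c)ᶜ) := by
          by_cases h1 : e = s(a, s)
          · subst h1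
            exact cross_of_sharp i0 i1 (cross_sharp_at_as w has hac hsc)
          by_cases h2 : e = s(a, c)
          · subst h2
            -- swap the roles of `s` and `c`
            have key := cross_sharp_at_as (V := Fin n) w (a := a) (s := c) (c := s) hac has (Ne.symm hsc)
            have hcs : (openConn c s : Set (BondConfig (Fin n))) = openConn s c := by
              ext ω; exact ⟨fun h => SimpleGraph.Reachable.symm h, fun h => SimpleGraph.Reachable.symm h⟩
            rw [Set.union_comm (openConn c a) (openConn s a), hcs] at key
            exact cross_of_sharp i0 i1 key
          by_cases h3 : e = s(s, c)
          · subst h3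
            have hU := infl_U_at_sc_eq_zero (V := Fin n) w (a := a) (s := s) (c := c) has hac
            have i1' := i1
            rw [hU] at i1' ⊢
            linarith [i0, i1']
          · exact h w e he h1 h2 h3 i0 i1
        have hp0 : (0 : ℝ) ≤ w e := (w e).2.1
        have hp1 : (w e : ℝ) ≤ 1 := (w e).2.2
        have hid := halving_pencil_identity w e s a c
        simp only at hid
        have key := pencil_nonneg hp0 hp1 (sub_nonneg.2 i0) (sub_nonneg.2 i1) (by linarith [hX] :
          (0 : ℝ) ≤ 2 * (prodBernoulli (Function.update w e 0)).real ((openConn s a ∪ openConn c a) ∩ (openConn s c)ᶜ) +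
            2 * (prodBernoulli (Function.update w e 1)).real ((openConn s a ∪ openConn c a) ∩ (openConn s c)ᶜ) -
            (prodBernoulli (Function.update w e 0)).real (openConn s a ∪ openConn c a) *
              (prodBernoulli (Function.update w e 1)).real ((openConn s c)ᶜ) -
            (prodBernoulli (Function.update w e 1)).real (openConn s a ∪ openConn c a) *
              (prodBernoulli (Function.update w e 0)).real ((openConn s c)ᶜ))
        linarith [hid, key]

end HalvingCross

end Summit.CriticalPhenomena.PercolationContinuityZ3.Theorems

end
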